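import Literature.NumberTheory.Automorphic.JacquetLineExponents
import Literature.NumberTheory.Automorphic.ConstituentsOfExtension
import Literature.NumberTheory.Automorphic.JacquetModuleExactProofs
import HarnessLib

/-!
# The labelled pair of a length-two representation with a two-dimensional Jacquet module ([Casselman1995, §7.1], packaged)

Generic representation theory (theorems only; no definition, no named fact, no instance), the ONE-CALL form of ★ `JacquetLineExponents` +
★ `ConstituentsOfExtension` + ★ `jacquet_exact_holds` used by the T3 «KeysCaseTwo» pay-down of cell pub/hodgecm-mathlib F0∕P3 (stub S2): for a
parabolic triple `t = (P, M, N_P)` of a topological group `G` with `N_P` the union of its compact open subgroups, a smooth `ρ` on `V : Type`, and a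
`G`-stable `N ≤ ρ` with `ρ|_N` and `ρ⁄N` irreducible, IF `r(ρ)` is two-dimensional with a stable line (`θ₁`) and quotient character `θ₂ ≠ θ₁`,
`r(ρ|_N) ≠ 0` and `θ₁` is not an exponent of `ρ|_N`, THEN: the classes `⟦ρ|_N⟧ ≠ ⟦ρ⁄N⟧` are the constituents of `ρ`, `r(ρ|_N) ≅ θ₂` and
`r(ρ⁄N) ≅ θ₁` as `M`-modules.

## References
[Casselman1995] W. Casselman, *Introduction to the theory of admissible representations of p-adic reductive groups* (draft 1995), Prop. 3.2.3,
§6.4, L. 7.1.1, Cor. 7.1.2, Prop. 7.1.3 · [BernsteinZelevinsky1977] §1.9, §2.3 · [BushnellHenniart2006] §2.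
-/

set_option autoImplicit false

noncomputable section

open scoped MonoidAlgebra
open Literature.RepresentationTheory.FiniteGroups Literature.RepresentationTheory.Semisimple

namespace Literature.NumberTheory.Automorphic

namespace IrrClass

universe u

variable {G : Type u} [Group G] [TopologicalSpace G] [IsTopologicalGroup G]
  (t : ParabolicTriple G) [LocallyCompactSpace t.P]

omit [TopologicalSpace G] [IsTopologicalGroup G] [LocallyCompactSpace t.P] in
/-- The Jacquet map of an equivalence of representations is injective (its inverse is the Jacquet map of the inverse).
[cite: BernsteinZelevinsky1977, §1.8] -/
theorem jacquetMap_equiv_injective {V W : Type*} [AddCommGroup V] [Module ℂ V] [AddCommGroup W] [Module ℂ W]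
    {ρ : Representation ℂ G V} {σ : Representation ℂ G W} (e : ρ.Equiv σ) :
    Function.Injective (Representation.jacquetMap t e.toIntertwiningMap) := by
  refine Function.LeftInverse.injective (g := Representation.jacquetMap t e.symm.toIntertwiningMap) fun x => ?_
  obtain ⟨y, rfl⟩ := Representation.Coinvariants.mk_surjective _ x
  rw [Representation.jacquetMap_mk, Representation.jacquetMap_mk]
  exact congrArg _ (e.symm_apply_apply y)

omit [TopologicalSpace G] [IsTopologicalGroup G] [LocallyCompactSpace t.P] t in
/-- `0 → ρ|_N → ρ → ρ⁄N → 0`: the inclusion and the quotient map form an exact pair. [cite: BushnellHenniart2006, §2] -/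
theorem exact_subtype_mkQ {V : Type*} [AddCommGroup V] [Module ℂ V] {ρ : Representation ℂ G V} (N : Subrepresentation ρ) :
    Function.Exact (Subrepresentation.subtypeIntertwiningMap N) N.mkQ := by
  intro y
  rw [N.mkQ_eq_zero_iff]
  constructor
  · intro hy; exact ⟨⟨y, hy⟩, rfl⟩
  · rintro ⟨x, rfl⟩; exact x.2

/-- **THE LABELLED PAIR** ([Casselman1995, §7.1] packaged): see the module docstring.  Output, in order: `⟦ρ|_N⟧ ≠ ⟦ρ⁄N⟧`; the constituents of
`ρ` are exactly `⟦ρ⁄N⟧`, `⟦ρ|_N⟧`; `r(ρ|_N) ≅ (trivial ℂ M ℂ) ⊗ θ₂`; `r(ρ⁄N) ≅ (trivial ℂ M ℂ) ⊗ θ₁`.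
[cite: Casselman1995, L. 7.1.1 (a), Cor. 7.1.2, Prop. 7.1.3, Prop. 6.4.1, Prop. 3.2.3] [cite: BernsteinZelevinsky1977, §1.9, Cor. 2.13 (c)] -/
theorem labelledPair_of_line (hNlim : IsLimitOfCompactOpen t.N) {V : Type} [AddCommGroup V] [Module ℂ V] {ρ : Representation ℂ G V}
    (hρ : ρ.IsSmooth) (N : Subrepresentation ρ) (hN : N.toRepresentation.IsIrreducible) (hQ : N.quotientRep.IsIrreducible)
    {θ₁ θ₂ : ↥t.M →* ℂˣ} (hne : θ₁ ≠ θ₂)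
    [FiniteDimensional ℂ (t.restrict ρ).Coinvariants] (h2 : Module.finrank ℂ (t.restrict ρ).Coinvariants = 2)
    (ℓ : Submodule ℂ (t.restrict ρ).Coinvariants) (hℓ1 : Module.finrank ℂ ↥ℓ = 1)
    (hℓ : ∀ (m : ↥t.M), ∀ x ∈ ℓ, ρ.normalizedJacquet t m x = ((θ₁ m : ℂˣ) : ℂ) • x)
    (hq : ∀ (m : ↥t.M) (x : (t.restrict ρ).Coinvariants), ρ.normalizedJacquet t m x - ((θ₂ m : ℂˣ) : ℂ) • x ∈ ℓ)
    [Nontrivial (t.restrict N.toRepresentation).Coinvariants] (hno : ¬ N.toRepresentation.HasJacquetExponent t θ₁) :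
    IrrClass.mk (SmoothIrrep.mk ↥N.toSubmodule N.toRepresentation hN (hρ.toRepresentation N)) ≠
        IrrClass.mk (SmoothIrrep.mk (V ⧸ N.toSubmodule) N.quotientRep hQ (hρ.quotientRep N)) ∧
      (∀ c : IrrClass G, c.IsConstituentOf ρ ↔
        (c = IrrClass.mk (SmoothIrrep.mk (V ⧸ N.toSubmodule) N.quotientRep hQ (hρ.quotientRep N)) ∨
          c = IrrClass.mk (SmoothIrrep.mk ↥N.toSubmodule N.toRepresentation hN (hρ.toRepresentation N)))) ∧
      Nonempty ((N.toRepresentation.normalizedJacquet t).Equiv ((Representation.trivial ℂ ↥t.M ℂ).twist θ₂)) ∧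
      Nonempty ((N.quotientRep.normalizedJacquet t).Equiv ((Representation.trivial ℂ ↥t.M ℂ).twist θ₁)) := by
  -- exactness of `r` along `0 → N → ρ → ρ⁄N → 0`
  obtain ⟨hJinj, hJex, hJsurj⟩ := Representation.jacquet_exact_holds (k := ℂ) t hNlim (hρ.toRepresentation N) hρ
    (hρ.quotientRep N) (Subrepresentation.subtypeIntertwiningMap N) N.mkQ (Subrepresentation.subtypeIntertwiningMap_injective N)
    (exact_subtype_mkQ N) N.mkQ_surjective
  -- the line bookkeeping
  obtain ⟨h1N, hactN⟩ := Representation.finrank_eq_one_and_normalizedJacquet_eq_of_line t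
    (Subrepresentation.subtypeIntertwiningMap N) hJinj h2 ℓ hℓ1 hℓ hq hno
  obtain ⟨hfdQ, h1Q, hactQ⟩ := Representation.finrank_eq_one_and_normalizedJacquet_eq_quot_of_line t
    (Subrepresentation.subtypeIntertwiningMap N) N.mkQ hJinj hJex hJsurj h2 ℓ hℓ1 hℓ hq hne hno
  haveI : FiniteDimensional ℂ (t.restrict N.toRepresentation).Coinvariants :=
    Module.Finite.of_injective (Representation.jacquetMap t (Subrepresentation.subtypeIntertwiningMap N)).toLinearMap hJinj
  haveI := hfdQ
  refine ⟨fun heq => ?_, fun c => isConstituentOf_iff_of_isIrreducible hρ N hN hQ c,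
    Representation.nonempty_normalizedJacquet_equiv_twist_of_finrank_eq_one t h1N hactN,
    Representation.nonempty_normalizedJacquet_equiv_twist_of_finrank_eq_one t h1Q hactQ⟩
  -- `⟦ρ|_N⟧ = ⟦ρ⁄N⟧` would transport the exponent `θ₂` of `ρ|_N` to `ρ⁄N`, where `θ₁` reigns
  obtain ⟨e⟩ := (IrrClass.mk_eq_mk_iff _ _).1 heq
  have hexpQ : N.quotientRep.HasJacquetExponent t θ₂ :=
    (Representation.hasJacquetExponent_of_forall_eq_smul t hactN).map_of_injective t e.toIntertwiningMap
      (jacquetMap_equiv_injective t e)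
  exact hne (Representation.HasJacquetExponent.eq_of_forall_eq_smul t hactQ hexpQ).symm

end IrrClass

end Literature.NumberTheory.Automorphic

end
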